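/-
Origin: expansion seat `planner-pub-hodgecm-pv02-g4-0`, handover #1 v2 2026-08-18T07:03:55Z (`HOME/pub-hodgecm-pv02-g4/lean/Pv02g4/ArchAFock.lean`, md5 43b7c077, 568 lines);
landed by the gen-7 packager in gate run 25 as `HodgeCM/PerL34/ArchAFock.lean` (stripped 9 #print/#check/#eval lines).
-/
/-
Origin: HOME/pub-hodgecm-pv02-g4/lean/Pv02g4/ArchAFock.lean — session planner-pub-hodgecm-pv02-g4-0 (unit
pub-hodgecm-pv02-g4, DAG-NODE PROVER #02 gen 4; successor of pv02 / pv02-g2 / pv02-g3).  CLAIMED in HOME/STATUS.md Log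
2026-08-18T06:51:35Z.  Intended final place: `HodgeCM/PerL34/ArchAFock.lean`; namespaces `HodgeCM.PerL34.Fock` (§§1–2)
and `HodgeCM.PerL34.ArchA` (§3).  Imports LANDED modules only — `ArchA` (pv02, run 19), `ArchCFock` (pv12-g2, run 22),
`FockLieModule` (pv05-g3, run 24), `FockGroupInvariants` (pv12-g4, run 24) — and one Mathlib file; no `Pv*` import,
nothing to rewrite.  Asserts nothing: no axiom, no placeholder proof; every data field of §3 carries its ArchA label.
-/
import Summits.HodgeConjecture.HodgeCM.PerL34.ArchA
import Summits.HodgeConjecture.HodgeCM.PerL34.ArchCFock_2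
import Summits.HodgeConjecture.HodgeCM.PerL34.FockLieModule
import Summits.HodgeConjecture.HodgeCM.PerL34.FockGroupInvariants_3
import Mathlib.LinearAlgebra.Eigenspace.Basic

set_option autoImplicit false

/-!
# N27 = PerL v5 Lemma 4.1(a): the two PRINT inputs of `ArchA.LineArchData.N27_of` are KERNEL over the explicit Fock model

NODE.  N27 = [PerL] v5 Lemma 4.1(a) `lem:arch`(a), tex ll. 480–482 (statement, verbatim in `ArchA.lean`), proof
ll. 493–496.  pv02's LANDED theorem (run 19)

  `ArchA.LineArchData.N27_of (hT : D.ThetaKernel) (hW : D.WeightAction) (hD : D.WeightDecomposition) : D.N27_statement`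

proves it over the posited one-line data `D : LineArchData` from THREE labelled inputs: `ThetaKernel` [DEFINITIONAL,
tex ll. 262–266: continuity of the theta kernel on the compact `[U(W_i)]` and `θ_{ω(u)φ}(·,u') = θ_φ(·,u'u)`], and the
two PRINT inputs (`ArchA.lean` :168, :173)

  `WeightAction        : ∀ b k (u : Circle), ∀ φ ∈ D.piece b k, D.ωb b u φ = ((u : ℂ) ^ k) • φ`   [BW VIII 2.7]
  `WeightDecomposition : ∀ b, ⨆ k, D.piece b k = ⊤`                                             [BW VIII 2.7(1), 2.8(1), 2.10(1)]

([BW] = Borel–Wallach, *Continuous cohomology, discrete subgroups, and representations of reductive groups*, 2nd ed.,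
AMS Math. Surveys 67 (2000), Ch. VIII, PDF p0196–p0197: `L²(ℝⁿ) = ⊕_k L²_k(ℝⁿ)`, `L²_k` := the `ξ_k`-eigenspace of
the centre `Exp(tJ_{p,q})`, and the `U(1)·K`-finite vectors are the algebraic sum).  In PerL the space `𝒮` of
l. 262 IS, at the real places, the polynomial Fock model (`ArchA.LineArchData.S` docstring: "Fock = `U(1)·K`-finite
vectors at the real places"; tex ll. 263–264 "at the archimedean place we use the Fock (polynomial) model, i.e.
`K`-finite vectors", l. 473 "let `\mathcal F_{i,b}` be the Fock model of `\omega_{W_i,b}`"), i.e. pv12's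
`Fock.HarmModel = ℂ[z₁,z₂,w]` at `ι₁`
(pair `(U(1), U(2,1))`, `FockKTypes.lean` (F3), run 20) and `Fock.DefModel = ℂ[z₁,z₂,z₃]` at `b ≠ ι₁` (pair
`(U(1), U(3))`, (F4)), on which `U(W_{i,b}) = U(1)` acts by the variable scaling `z_a ↦ u z_a, w ↦ u⁻¹ w` ((F2),
`Fock.uWt`) resp. `z_a ↦ u z_a`, times a vacuum character `u ↦ u^{k₀}` (`k₀ ∈ ℤ` in PerL's normalisation, tex l. 476:
"`U(W_{i,b}) = U(1)` acts on it by a character `u ↦ u^{-e_b(Ψ_i)}`, which *defines* `e_b(Ψ_i) ∈ ℤ`").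

WHAT THIS FILE DOES (the N27 analogue of pv12-g2's `ArchCFock` for S4/N28 and pv08-g4's `S5QautFock` for S5):

* §1 KERNEL (Mathlib only).  `Fock.weightSpace ρ k := ⨅ u, eigenspace (ρ u) (u^k)` — the `u ↦ u^k` weight space of
  a representation `ρ : Circle →* Module.End ℂ V` ([BW] VIII 2.7's DEFINITION of `L²_k`); `Fock.slotAct b ρ` — the
  representation "`ρ` in slot `b`, identity elsewhere" of `U(1)` on a finite tensor product `⨂[ℂ] i, M i` (pv12-g2's
  `Fock.slot`, made a monoid hom); and the TRANSPORT theorem `Fock.iSup_weightSpace_slotAct_eq_top`: if the slot-`b`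
  factor is the sum of its weight spaces then so is the tensor product (a pure tensor with a weight vector in slot `b`
  is a weight vector, `tprod_update_mem_weightSpace`; pure tensors span).
* §2 KERNEL over pv12/pv05's explicit models.  `Fock.circleScale s k₀ : Circle →* Module.End ℂ ℂ[X_σ]`,
  `u ↦ u^{k₀} • (X_i ↦ u^{s_i} X_i)` (pv12-g4's `GroupLevel.scale`), for integer weights `s` and vacuum twist `k₀`;
  `coeff_circleScale` (diagonal on monomials with eigenvalue `u^{k₀ + wt s m}`); **`circleScale_apply_of_mem_wpiece`**:
  on pv12's weight piece `wpiece s k` (= pv05-g3's `F_k` / `Sym^d`: `hpiece k = wpiece uWt k`, `dpiece d = wpiece 1 d`)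
  the circle acts by `u^{k + k₀}` — this IS `WeightAction` for the explicit model; **`weightSpace_circleScale_eq`**:
  the weight spaces of `circleScale s k₀` ARE the `wpiece s (k - k₀)` (so at `ι₁` the `piece`s of §3 are exactly
  pv05/pv12's `F_k`, shifted by the vacuum twist); **`iSup_weightSpace_circleScale_eq_top`**: `ℂ[X_σ]` is the sum of
  the weight spaces — from pv05-g3's `wpiece_isInternal` (`ℂ[X_σ] = ⊕_k wpiece s k`, run 24) — this IS
  `WeightDecomposition` for the explicit model.  Named instances: `harmCircle k₀` (`ℂ[z₁,z₂,w]`, weights `uWt`) and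
  `defCircle k₀` (`ℂ[z₁,z₂,z₃]`, weights `1`), with `harmCircle_apply_of_mem_hpiece`, `defCircle_apply_of_mem_dpiece`,
  `iSup_weightSpace_harmCircle_eq_top`, `iSup_weightSpace_defCircle_eq_top`; §2″ the NAMING DATUM `kJ` computed:
  `mem_weightSpace_harmCircle_iff_inJplus` (weight `1 + k₀` at `ι₁` = pv12's `J⁺`-piece `InJplus` = `F_1` = pv14-g3's
  `jplusSubmodule`), `mem_weightSpace_defCircle_self_iff` (weight `k₀` at `b ≠ ι₁` = the vacuum line of constants = `𝟏`).
* §2' `Fock.LocalWeil` = ONE tensor slot of `𝒮`: a module `M` with a `U(1)`-representation `ρ` and the local content of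
  `WeightDecomposition` as the field `dec : ⨆ k, weightSpace ρ k = ⊤`; KERNEL constructors `LocalWeil.ofPoly σ s k₀`
  (any polynomial Fock model), `LocalWeil.harm k₀` (slot of `ι₁`), `LocalWeil.def k₀` (slot of `b ≠ ι₁`) and
  `LocalWeil.inert N` (a slot on which this circle does not act: the finite-adelic factor `𝒮(V(𝔸_f))`, `dec` trivial).
* §3 `ArchA.FockLineArchBridge` = `ArchA.LineArchData` with the free data `S`, `ωb`, `piece` REPLACED by a finite
  family of slots `loc : Slot → LocalWeil` (the factorisation `𝒮((V₃ ⊗ W_i)(𝔸)) = (⊗_{b real} 𝒮_b) ⊗ 𝒮(V(𝔸_f))`, tex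
  l. 262 with §4.1 l. 472–474), the slot `slotOf b` of each real place, and `S := ⨂[ℂ] i, (loc i).M`,
  `ωb b := slotAct (slotOf b) (loc (slotOf b)).ρ` (`U(W_{i,b})` acts on the `b`-th archimedean factor, l. 476),
  `piece b k := weightSpace (ωb b) k` ([BW] VIII 2.7: the weight spaces are DEFINED as the `u^k`-eigenspaces) — every
  other field (`Q`, `μ`, `toQ`, `A`, `Θ`, `kJ`, `X`, `χQ`) carried VERBATIM with its ArchA label.  Then
  `toLineArchData`, **`weightAction : B.toLineArchData.WeightAction`** (definitional) and **`weightDecomposition :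
  B.toLineArchData.WeightDecomposition`** (§1 transport of the slots' `dec`), hence BY NAME
  **`N27_of_fock (hT : B.toLineArchData.ThetaKernel) : B.toLineArchData.N27_statement`** — pv02's `N27_of` with the
  two PRINT inputs DISCHARGED; only the DEFINITIONAL `ThetaKernel` (tex ll. 262–266) is left.

NET for LEMMAS.md §1 N27 / §9.  After this file the representation-theoretic inputs of Lemma 4.1(a) are KERNEL end to
end for the intended model (explicit local Fock models → tensor product over the slots → `WeightAction` /
`WeightDecomposition` → `N27_of`), and the NAMING datum `kJ b` ([BW] VIII 2.8/2.14: which weight carries `J⁺` resp.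
`𝟏`) is COMPUTED by §2″ (`1 + k₀` at `ι₁`, `k₀` at `b ≠ ι₁`); what remains of N27 is ONLY the definitional theta-kernel
line `ThetaKernel`.
VACUITY NOTE (for referees 2/3/adv).  `LocalWeil` allows ANY slot whose circle action is the sum of its weight spaces
(so that the finite-adelic factor and base-changed / conjugate local models are served by the same record); the
INTENDED instance is `loc (slotOf ι₁) := LocalWeil.harm k₀`, `loc (slotOf b) := LocalWeil.def k₀'` (`b ≠ ι₁`, sign type
by N13/N26), `loc fin := LocalWeil.inert 𝒮(V(𝔸_f))`, for which `dec` is the kernel theorem of §2.  A junk slot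
(`M = 0`) makes `S = 0` and every theta lift zero, so that `N27_statement` holds vacuously for that junk datum exactly as
it already does for a junk `LineArchData` — no field of the bridge restates N27 or any conjunct of it, and
`toLineArchData` adds no hypothesis.  Standard axiom trio only (see the `#print axioms` lines at the end).
-/

noncomputable section

open Function MvPolynomial
open scoped TensorProduct BigOperators

namespace HodgeCM
namespace PerL34

/-! ## §1  Weight spaces of a circle action; transport to one slot of a finite tensor product (Mathlib only) -/

namespace Fock

section WeightSpace

variable {V : Type*} [AddCommGroup V] [Module ℂ V]

/-- The `u ↦ u^k` weight space of a representation `ρ` of `U(1) = Circle` on `V`: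
`{v | ∀ u, ρ u v = u^k • v} = ⨅ u, eigenspace (ρ u) (u^k)` ([BW] VIII 2.7: `L²_k` := the `ξ_k`-eigenspace). -/
def weightSpace (ρ : Circle →* Module.End ℂ V) (k : ℤ) : Submodule ℂ V :=
  ⨅ u : Circle, Module.End.eigenspace (ρ u) ((u : ℂ) ^ k)

/-- (Ported verbatim from the HodgeCMPerL package; no docstring in the source.) -/
theorem mem_weightSpace_iff (ρ : Circle →* Module.End ℂ V) (k : ℤ) (v : V) :
    v ∈ weightSpace ρ k ↔ ∀ u : Circle, ρ u v = ((u : ℂ) ^ k) • v := by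
  simp only [weightSpace, Submodule.mem_iInf, Module.End.mem_eigenspace_iff]

/-- The trivial representation has everything in weight `0`. -/
theorem weightSpace_one_zero : weightSpace (1 : Circle →* Module.End ℂ V) 0 = ⊤ := by
  rw [eq_top_iff]
  intro v _
  rw [mem_weightSpace_iff]
  intro u
  rw [MonoidHom.one_apply, Module.End.one_apply, zpow_zero, one_smul]

end WeightSpace

section SlotAction

variable {I : Type*} [Fintype I] [DecidableEq I]
variable {M : I → Type*} [∀ i, AddCommGroup (M i)] [∀ i, Module ℂ (M i)]

/-- The representation "`ρ` in slot `b`, identity in every other slot" of `U(1)` on `⨂[ℂ] i, M i`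
(`U(W_{i,b})` acting on the `b`-th archimedean factor of `𝒮 = ⊗'_v 𝒮_v`; pv12-g2's `Fock.slot` as a monoid hom). -/
def slotAct (b : I) (ρ : Circle →* Module.End ℂ (M b)) : Circle →* Module.End ℂ (⨂[ℂ] i, M i) where
  toFun u := slot b (ρ u)
  map_one' := by
    refine PiTensorProduct.ext ?_
    ext m
    simp only [LinearMap.compMultilinearMap_apply]
    rw [map_one, slot_tprod, Module.End.one_apply, Module.End.one_apply, update_eq_self]
  map_mul' u v := by
    refine PiTensorProduct.ext ?_
    ext m
    simp only [LinearMap.compMultilinearMap_apply]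
    rw [map_mul, slot_tprod, Module.End.mul_apply, Module.End.mul_apply, slot_tprod, slot_tprod, update_self,
      update_idem]

/-- (Ported verbatim from the HodgeCMPerL package; no docstring in the source.) -/
theorem slotAct_apply (b : I) (ρ : Circle →* Module.End ℂ (M b)) (u : Circle) :
    slotAct b ρ u = slot b (ρ u) := rfl

/-- (Ported verbatim from the HodgeCMPerL package; no docstring in the source.) -/
theorem slotAct_tprod (b : I) (ρ : Circle →* Module.End ℂ (M b)) (u : Circle) (m : Π i, M i) :
    slotAct b ρ u (PiTensorProduct.tprod ℂ m) = PiTensorProduct.tprod ℂ (update m b (ρ u (m b))) :=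
  slot_tprod b (ρ u) m

/-- A pure tensor with a weight-`k` vector in slot `b` is a weight-`k` vector of the slot action. -/
theorem tprod_update_mem_weightSpace (b : I) (ρ : Circle →* Module.End ℂ (M b)) (m : Π i, M i) {k : ℤ}
    {x : M b} (hx : x ∈ weightSpace ρ k) :
    PiTensorProduct.tprod ℂ (update m b x) ∈ weightSpace (slotAct b ρ) k := by
  rw [mem_weightSpace_iff] at hx ⊢
  intro u
  rw [slotAct_tprod, update_self, update_idem, hx u, MultilinearMap.map_update_smul]

/-- **Transport.**  If the slot-`b` factor is the sum of its `U(1)`-weight spaces, so is `⨂[ℂ] i, M i` for the slot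
action (every pure tensor is a finite sum of pure tensors with a weight vector in slot `b`; pure tensors span). -/
theorem iSup_weightSpace_slotAct_eq_top (b : I) (ρ : Circle →* Module.End ℂ (M b))
    (hρ : ⨆ k : ℤ, weightSpace ρ k = ⊤) : ⨆ k : ℤ, weightSpace (slotAct b ρ) k = ⊤ := by
  have key : ∀ m : Π i, M i, PiTensorProduct.tprod ℂ m ∈ ⨆ k : ℤ, weightSpace (slotAct b ρ) k := by
    intro m
    -- vary slot `b` linearly, all other slots of `m` fixed
    let L : M b →ₗ[ℂ] ⨂[ℂ] i, M i := (PiTensorProduct.tprod ℂ).toLinearMap m b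
    have hL : ∀ x, L x = PiTensorProduct.tprod ℂ (update m b x) := fun x => rfl
    have hcomap : (⨆ k : ℤ, weightSpace (slotAct b ρ) k).comap L = ⊤ := by
      rw [eq_top_iff, ← hρ, iSup_le_iff]
      intro k x hx
      show L x ∈ ⨆ k : ℤ, weightSpace (slotAct b ρ) k
      rw [hL]
      exact Submodule.mem_iSup_of_mem k (tprod_update_mem_weightSpace b ρ m hx)
    have hmb : m b ∈ (⨆ k : ℤ, weightSpace (slotAct b ρ) k).comap L := by
      rw [hcomap]
      exact Submodule.mem_top
    have hmb' : L (m b) ∈ ⨆ k : ℤ, weightSpace (slotAct b ρ) k := hmb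
    rw [hL, update_eq_self] at hmb'
    exact hmb'
  rw [eq_top_iff, ← PiTensorProduct.span_tprod_eq_top, Submodule.span_le]
  rintro _ ⟨m, rfl⟩
  exact key m

end SlotAction

/-! ## §2  The explicit local models: `U(1)` acting on `ℂ[X_σ]` by variable scaling (times a vacuum character) -/

section CircleScale

open GroupLevel

variable {σ : Type*}

/-- `∏_{i ∈ t} u^{f i} = u^{Σ_{i ∈ t} f i}` on the circle (`u ≠ 0`). -/
theorem prod_coe_zpow_eq (u : Circle) (f : σ → ℤ) (t : Finset σ) :
    ∏ i ∈ t, (u : ℂ) ^ f i = (u : ℂ) ^ ∑ i ∈ t, f i := by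
  classical
  induction t using Finset.induction_on with
  | empty => rw [Finset.prod_empty, Finset.sum_empty, zpow_zero]
  | insert a t ha ih => rw [Finset.prod_insert ha, Finset.sum_insert ha, ih, zpow_add₀ (Circle.coe_ne_zero u)]

/-- The operator `u^{k₀} · (X_i ↦ u^{s_i} X_i)` on `ℂ[X_σ]` (vacuum character `u^{k₀}` times variable scaling). -/
def circleScaleEnd (s : σ → ℤ) (k₀ : ℤ) (u : Circle) : Module.End ℂ (MvPolynomial σ ℂ) :=
  ((u : ℂ) ^ k₀) • (scale fun i => (u : ℂ) ^ s i).toLinearMap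

/-- (Ported verbatim from the HodgeCMPerL package; no docstring in the source.) -/
theorem circleScaleEnd_apply (s : σ → ℤ) (k₀ : ℤ) (u : Circle) (f : MvPolynomial σ ℂ) :
    circleScaleEnd s k₀ u f = ((u : ℂ) ^ k₀) • scale (fun i => (u : ℂ) ^ s i) f := rfl

variable [Fintype σ]

/-- The scaling factor of the monomial `m` under `X_i ↦ u^{s_i} X_i` is `u^{wt s m}`. -/
theorem scaleFactor_coe_zpow (u : Circle) (s : σ → ℤ) (m : σ →₀ ℕ) :
    scaleFactor (fun i => (u : ℂ) ^ s i) m = (u : ℂ) ^ wt s m := by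
  rw [scaleFactor_eq_prod, wt, ← prod_coe_zpow_eq]
  refine Finset.prod_congr rfl fun i _ => ?_
  rw [← zpow_natCast, ← zpow_mul]

/-- Diagonal on monomials: the coefficient of `m` is multiplied by `u^{k₀} · u^{wt s m}`. -/
theorem coeff_circleScaleEnd (s : σ → ℤ) (k₀ : ℤ) (u : Circle) (f : MvPolynomial σ ℂ) (m : σ →₀ ℕ) :
    coeff m (circleScaleEnd s k₀ u f) = (u : ℂ) ^ k₀ * (u : ℂ) ^ wt s m * coeff m f := by
  rw [circleScaleEnd_apply, coeff_smul, coeff_scale, scaleFactor_coe_zpow, smul_eq_mul]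
  ring

/-- **The `U(W) = U(1)`-representation on the polynomial Fock model `ℂ[X_σ]`** with scaling weights `s` and vacuum
twist `k₀`: `u ↦ u^{k₀} · (X_i ↦ u^{s_i} X_i)` — a monoid hom `Circle →* Module.End ℂ ℂ[X_σ]`. -/
def circleScale (s : σ → ℤ) (k₀ : ℤ) : Circle →* Module.End ℂ (MvPolynomial σ ℂ) where
  toFun := circleScaleEnd s k₀
  map_one' := by
    refine LinearMap.ext fun f => MvPolynomial.ext _ _ fun m => ?_
    rw [coeff_circleScaleEnd, Module.End.one_apply, Circle.coe_one, one_zpow, one_zpow, one_mul, one_mul]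
  map_mul' u v := by
    refine LinearMap.ext fun f => MvPolynomial.ext _ _ fun m => ?_
    rw [Module.End.mul_apply, coeff_circleScaleEnd, coeff_circleScaleEnd, coeff_circleScaleEnd, Circle.coe_mul,
      mul_zpow, mul_zpow]
    ring

/-- (Ported verbatim from the HodgeCMPerL package; no docstring in the source.) -/
theorem circleScale_apply (s : σ → ℤ) (k₀ : ℤ) (u : Circle) (f : MvPolynomial σ ℂ) :
    circleScale s k₀ u f = ((u : ℂ) ^ k₀) • scale (fun i => (u : ℂ) ^ s i) f := rfl

/-- (Ported verbatim from the HodgeCMPerL package; no docstring in the source.) -/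
theorem coeff_circleScale (s : σ → ℤ) (k₀ : ℤ) (u : Circle) (f : MvPolynomial σ ℂ) (m : σ →₀ ℕ) :
    coeff m (circleScale s k₀ u f) = (u : ℂ) ^ k₀ * (u : ℂ) ^ wt s m * coeff m f :=
  coeff_circleScaleEnd s k₀ u f m

/-- **`WeightAction` for the explicit model — KERNEL.**  On pv12's weight piece `wpiece s k` (pv05-g3's `F_k` /
`Sym^d`) the circle acts by the character `u ↦ u^{k + k₀}`. -/
theorem circleScale_apply_of_mem_wpiece (s : σ → ℤ) (k₀ : ℤ) {k : ℤ} {f : MvPolynomial σ ℂ}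
    (hf : f ∈ wpiece s k) (u : Circle) : circleScale s k₀ u f = ((u : ℂ) ^ (k + k₀)) • f := by
  refine MvPolynomial.ext _ _ fun m => ?_
  rw [coeff_circleScale, coeff_smul, smul_eq_mul]
  by_cases hm : m ∈ f.support
  · rw [(mem_wpiece_iff_support s k f).mp hf m hm, zpow_add₀ (Circle.coe_ne_zero u)]
    ring
  · rw [MvPolynomial.notMem_support_iff.mp hm, mul_zero, mul_zero]

/-- (Ported verbatim from the HodgeCMPerL package; no docstring in the source.) -/
theorem wpiece_le_weightSpace (s : σ → ℤ) (k₀ k : ℤ) : wpiece s k ≤ weightSpace (circleScale s k₀) (k + k₀) :=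
  fun _ hf => (mem_weightSpace_iff _ _ _).mpr (circleScale_apply_of_mem_wpiece s k₀ hf)

/-- **The weight spaces of the explicit model ARE pv05/pv12's pieces** (shifted by the vacuum twist):
`weightSpace (circleScale s k₀) k = wpiece s (k - k₀)`. -/
theorem weightSpace_circleScale_eq (s : σ → ℤ) (k₀ k : ℤ) : weightSpace (circleScale s k₀) k = wpiece s (k - k₀) := by
  refine le_antisymm ?_ ?_
  · intro f hf
    rw [mem_weightSpace_iff] at hf
    rw [mem_wpiece_iff_support]
    intro m hm
    have hc : coeff m f ≠ 0 := MvPolynomial.mem_support_iff.mp hm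
    -- on the monomial `m`: `u^{k₀} u^{wt s m} = u^k` for every `u`, hence `k₀ + wt s m = k`
    have hall : ∀ u : Circle, (u : ℂ) ^ (k₀ + wt s m) = (u : ℂ) ^ k := by
      intro u
      have h1 := congrArg (coeff m) (hf u)
      rw [coeff_circleScale, coeff_smul, smul_eq_mul] at h1
      rw [zpow_add₀ (Circle.coe_ne_zero u)]
      exact mul_right_cancel₀ hc h1
    by_contra hne
    obtain ⟨u, hu⟩ := ArchA.exists_zpow_ne_zpow (show k₀ + wt s m ≠ k by omega)
    exact hu (hall u)
  · have h := wpiece_le_weightSpace s k₀ (k - k₀)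
    rwa [sub_add_cancel] at h

/-- **`WeightDecomposition` for the explicit model — KERNEL** (from pv05-g3's `wpiece_isInternal`:
`ℂ[X_σ] = ⊕_k wpiece s k`): `ℂ[X_σ]` is the sum of the weight spaces of `circleScale s k₀`. -/
theorem iSup_weightSpace_circleScale_eq_top (s : σ → ℤ) (k₀ : ℤ) :
    ⨆ k : ℤ, weightSpace (circleScale s k₀) k = ⊤ := by
  classical
  rw [eq_top_iff, ← (wpiece_isInternal s).submodule_iSup_eq_top, iSup_le_iff]
  intro k
  exact (wpiece_le_weightSpace s k₀ k).trans (le_iSup (fun k' => weightSpace (circleScale s k₀) k') (k + k₀))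

end CircleScale

section NamedInstances

/-- The slot of `ι₁`: `U(W) = U(1)` on pv12's `ℂ[z₁,z₂,w]` by `z_a ↦ u z_a, w ↦ u⁻¹ w` ((F2), `uWt`) times `u^{k₀}`. -/
def harmCircle (k₀ : ℤ) : Circle →* Module.End ℂ HarmModel := circleScale uWt k₀

/-- The slot of a real place `b ≠ ι₁`: `U(1)` on `ℂ[z₁,z₂,z₃]` by `z_a ↦ u z_a` times `u^{k₀}`. -/
def defCircle (k₀ : ℤ) : Circle →* Module.End ℂ DefModel := circleScale (fun _ : Fin 3 => (1 : ℤ)) k₀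

/-- (Ported verbatim from the HodgeCMPerL package; no docstring in the source.) -/
theorem harmCircle_apply_of_mem_hpiece (k₀ : ℤ) {k : ℤ} {f : HarmModel} (hf : f ∈ hpiece k) (u : Circle) :
    harmCircle k₀ u f = ((u : ℂ) ^ (k + k₀)) • f :=
  circleScale_apply_of_mem_wpiece uWt k₀ hf u

/-- (Ported verbatim from the HodgeCMPerL package; no docstring in the source.) -/
theorem defCircle_apply_of_mem_dpiece (k₀ : ℤ) {d : ℕ} {f : DefModel} (hf : f ∈ dpiece d) (u : Circle) :
    defCircle k₀ u f = ((u : ℂ) ^ ((d : ℤ) + k₀)) • f :=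
  circleScale_apply_of_mem_wpiece (fun _ : Fin 3 => (1 : ℤ)) k₀ hf u

/-- at `ι₁` the weight-`k` space IS pv05/pv12's `F_{k-k₀}` -/
theorem weightSpace_harmCircle_eq (k₀ k : ℤ) : weightSpace (harmCircle k₀) k = hpiece (k - k₀) :=
  weightSpace_circleScale_eq uWt k₀ k

/-- (Ported verbatim from the HodgeCMPerL package; no docstring in the source.) -/
theorem iSup_weightSpace_harmCircle_eq_top (k₀ : ℤ) : ⨆ k : ℤ, weightSpace (harmCircle k₀) k = ⊤ :=
  iSup_weightSpace_circleScale_eq_top uWt k₀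

/-- (Ported verbatim from the HodgeCMPerL package; no docstring in the source.) -/
theorem iSup_weightSpace_defCircle_eq_top (k₀ : ℤ) : ⨆ k : ℤ, weightSpace (defCircle k₀) k = ⊤ :=
  iSup_weightSpace_circleScale_eq_top (fun _ : Fin 3 => (1 : ℤ)) k₀

/-! ### §2″ The naming datum `kJ` is COMPUTED in the model ([BW] VIII 2.8/2.14; PerL tex ll. 474–476)

`ArchA.LineArchData.kJ b` := "the weight of the summand carrying `J⁺` (`b = ι₁`) resp. `𝟏_{U(3)}` (`b ≠ ι₁`)".  In the
explicit models this is a theorem, not a datum: at `ι₁` the `J⁺`-piece — pv12's (F3) `Fock.InJplus` ("`U(1)_W`-weight 1"),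
= pv05-g3's `F_1 = hpiece 1` (`inJplus_iff`), = pv14-g3's `P43KTypesFock.jplusSubmodule` (r23, `mem_jplusSubmodule :
f ∈ jplusSubmodule ↔ InJplus f`) — IS the weight space of weight `1 + k₀` of `harmCircle k₀`; at `b ≠ ι₁` the vacuum line
`𝟏_{U(3)}` = the constants (pv05-g3 `mem_dpiece_zero_iff`) IS the weight space of weight `k₀` of `defCircle k₀`.  Hence for
the intended bridge of §3: `kJ ι₁ = 1 + k₀(ι₁)`, `kJ b = k₀(b)` (`k₀(b)` = the vacuum twist of the local Weil representation,
PerL l. 476), i.e. `e_{ι₁} = -(1 + k₀(ι₁))`, `e_b = -k₀(b)` in the normalisation of `LineArchData.e`. -/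

/-- at `ι₁`: the weight-`(1 + k₀)` space of `harmCircle k₀` is `F_1`, the `J⁺`-piece -/
theorem weightSpace_harmCircle_one_add (k₀ : ℤ) : weightSpace (harmCircle k₀) (1 + k₀) = hpiece 1 := by
  rw [weightSpace_harmCircle_eq, add_sub_cancel_right]

/-- at `ι₁`: membership in the weight-`(1 + k₀)` space is EXACTLY pv12's `InJplus` (the `J⁺`-piece, (F3)) -/
theorem mem_weightSpace_harmCircle_iff_inJplus (k₀ : ℤ) (f : HarmModel) :
    f ∈ weightSpace (harmCircle k₀) (1 + k₀) ↔ InJplus f := by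
  rw [weightSpace_harmCircle_one_add, inJplus_iff]

/-- at `b ≠ ι₁` the weight-`k` space IS `wpiece 1 (k - k₀)` (total degree `k - k₀`; `= dpiece d` when `k - k₀ = d ≥ 0`,
`= ⊥` when `k < k₀`) -/
theorem weightSpace_defCircle_eq (k₀ k : ℤ) :
    weightSpace (defCircle k₀) k = wpiece (fun _ : Fin 3 => (1 : ℤ)) (k - k₀) :=
  weightSpace_circleScale_eq (fun _ : Fin 3 => (1 : ℤ)) k₀ k

/-- at `b ≠ ι₁`: the weight-`k₀` space of `defCircle k₀` is `dpiece 0`, the vacuum line -/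
theorem weightSpace_defCircle_self (k₀ : ℤ) : weightSpace (defCircle k₀) k₀ = dpiece 0 := by
  rw [weightSpace_defCircle_eq, sub_self, dpiece, Nat.cast_zero]

/-- at `b ≠ ι₁`: membership in the weight-`k₀` space is EXACTLY "`f` is a constant" (the trivial `U(3)`-type `𝟏`,
pv05-g3 `mem_dpiece_zero_iff`; cf. pv12 (F4) `trivialType_occurs_iff`) -/
theorem mem_weightSpace_defCircle_self_iff (k₀ : ℤ) (f : DefModel) :
    f ∈ weightSpace (defCircle k₀) k₀ ↔ ∃ c : ℂ, f = C c := by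
  rw [weightSpace_defCircle_self, mem_dpiece_zero_iff]

end NamedInstances

/-! ## §2'  One tensor slot of `𝒮` with its `U(1)`-action and the local content of `WeightDecomposition` -/

/-- **One tensor slot of `𝒮((V₃ ⊗ W_i)(𝔸))`**: a module `M` with a representation `ρ` of `U(1)` and the local content
of [BW] VIII 2.7(1) as the field `dec` ("`M` is the sum of its weight spaces").  For the explicit local Fock models
`dec` is a KERNEL theorem: use `ofPoly` / `harm` / `def`; for a slot on which this circle does not act, `inert`.
(Carrier in `Type`, to fit `ArchA.LineArchData.S : Type`.) -/
structure LocalWeil where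
  /-- the local space -/
  M : Type
  [i₁ : AddCommGroup M]
  [i₂ : Module ℂ M]
  /-- the action of `U(1)` on it -/
  ρ : Circle →* Module.End ℂ M
  /-- `M` is the (algebraic) sum of its `U(1)`-weight spaces -/
  dec : ⨆ k : ℤ, weightSpace ρ k = ⊤

attribute [instance] LocalWeil.i₁ LocalWeil.i₂


-- port_pkg: scope closed for this part
end Fock
end PerL34
end HodgeCM
end
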